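import Summits.HodgeConjecture.HodgeCM.Model.ThetaSpaceSatHecke_1

/-! PORT of `HodgeCM/Model/ThetaSpaceSatHecke.lean` (HodgeCMPerL run 82) — part 2: continuation of `Summits.HodgeConjecture.HodgeCM.Model.ThetaSpaceSatHecke_1` (split at a top-level declaration boundary by port_pkg.py; scope re-opened below; declarations unchanged). -/

-- port_pkg: scope re-opened for this part (file-level context, then the namespace/section stack open at the cut)
set_option autoImplicit false
noncomputable section
open MeasureTheory NumberField NumberField.mixedEmbedding IsDedekindDomain
open Literature.NumberTheory.Automorphic Literature.NumberTheory.Weil1964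
open Literature.NumberTheory.Automorphic.WeightForms (restrictHom IsLevelCorrected IsWeightMatched restrictHom_apply
  comp_leftTranslate_eq_of_mem)
open HodgeCM.PerL34.Seesaw HodgeCM.PerL34.RationalCoset HodgeCM.PerL34.SupplyAdelic
open HodgeCM.Model.SupplyInstance HodgeCM.Model.SupplyResidual
namespace HodgeCM
namespace Model
namespace ThetaSpace
section HeckeSum
variable {K L : Type} [Field K] [NumberField K] [Field L] [NumberField L] [Algebra K L] [FiniteDimensional K L]
variable {J : Type} [Fintype J] {GU : Type} [Group GU] [TopologicalSpace GU] [IsTopologicalGroup GU]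
  [LocallyCompactSpace GU]
variable {P : WeilPairData K L J GU} [CompactSpace (GU ⧸ P.ΓU)]
variable {G₁ K₁ W : Type} [Group G₁] [Group K₁] [AddCommGroup W] [Module ℂ W] [Module.IsReflexive ℂ W]
variable {ιinf : G₁ →* GU} {Δ : Subgroup G₁} {κ₁ : K₁ →* G₁} {τ₁ : Representation ℂ K₁ W}
variable {Q : Type} [Fintype Q]
/-- **The theta forms of `S` Hecke-sum into those of the summed situation**: for `θ ∈ S.thetaForms 𝓕` the function
`g ↦ Σ_q θ (g (k q)⁻¹)` is (the coercion of) an element of `(S.sumTranslateStrict k …).thetaForms 𝓕`. -/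
theorem KTypeSituation.exists_mem_thetaForms_coe_eq_sum (S : KTypeSituation P ιinf Δ κ₁ τ₁) (hstr : S.IsStrict)
    {KΓ : Subgroup GU} (hS : S.IsSaturated KΓ) (k : Q → GU) (hk : ∀ q (x : G₁), Commute (k q) (ιinf x))
    (hKΓ : ∀ a ∈ KΓ, ∀ x : G₁, Commute a (ιinf x))
    (hQ : ∀ a ∈ KΓ, ∃ e : Q ≃ Q, ∀ q, k (e q) * a * (k q)⁻¹ ∈ KΓ)
    (hcorr : ∀ δ ∈ Δ, ∃ x ∈ KΓ, ιinf δ * x ∈ P.ΓU ∧ ∀ y : G₁, Commute x (ιinf y))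
    (𝓕 : Set C(relNormOneIdeles K L ⧸ relNormOneRat K L, ℂ))
    {θ : weightForms P.ΓU S.κ S.τ} (hθ : θ ∈ S.thetaForms 𝓕) :
    ∃ θ' ∈ (S.sumTranslateStrict k hS hKΓ hcorr).thetaForms 𝓕,
      (θ'.1 : GU → W) = fun g => ∑ q, (θ.1 : GU → W) (g * (k q)⁻¹) := by
  replace hθ : θ ∈ Submodule.span ℂ {F | ∃ j ∈ S.𝓙, ∃ f ∈ 𝓕,
      F = P.kernelDatum.thetaForm (probHaarRelNormOneQuot K L) P.kernelDatum_thetaLinear S.κ j.1 j.2 S.ι S.hι f} := hθ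
  induction hθ using Submodule.span_induction with
  | mem F hF =>
      obtain ⟨j, hj, f, hf, rfl⟩ := hF
      have hj' : (⟨S.sumFamily k j.1, hstr.isThetaEquivariant_sumFamily hS k hk hKΓ hQ hcorr hj⟩ :
          {j' : (S.sumTranslateStrict k hS hKΓ hcorr).E →ₗ[ℂ] P.weilDatum.ThetaTop //
            P.kernelDatum.IsThetaEquivariant (S.sumTranslateStrict k hS hKΓ hcorr).κ
              (S.sumTranslateStrict k hS hKΓ hcorr).σ j'}) ∈ (S.sumTranslateStrict k hS hKΓ hcorr).𝓙 :=
        ⟨j, hj, fun ℓ => S.sumFamily_apply k j.1 ℓ⟩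
      exact ⟨_, P.kernelDatum.thetaForm_mem_thetaForms (probHaarRelNormOneQuot K L) P.kernelDatum_thetaLinear
          (S.sumTranslateStrict k hS hKΓ hcorr).κ (S.sumTranslateStrict k hS hKΓ hcorr).σ
          (S.sumTranslateStrict k hS hKΓ hcorr).ι (S.sumTranslateStrict k hS hKΓ hcorr).hι hj' hf,
        S.coe_thetaForm_sumTranslateStrict k hS hKΓ hcorr (fun ℓ => S.sumFamily_apply k j.1 ℓ) f⟩
  | zero =>
      exact ⟨0, Submodule.zero_mem _, by funext g; simp⟩
  | add x y _ _ hx hy =>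
      obtain ⟨x', hx', hxe⟩ := hx
      obtain ⟨y', hy', hye⟩ := hy
      refine ⟨x' + y', Submodule.add_mem _ hx' hy', ?_⟩
      funext g
      simp only [Submodule.coe_add, Pi.add_apply, hxe, hye, Finset.sum_add_distrib]
  | smul a x _ hx =>
      obtain ⟨x', hx', hxe⟩ := hx
      refine ⟨a • x', Submodule.smul_mem _ a hx', ?_⟩
      funext g
      simp only [Submodule.coe_smul, Pi.smul_apply, hxe, Finset.smul_sum]

/-! ### § 5. The consumer statement: Hecke sums at fixed `(Δ, KΓ)` -/

/-- **Hecke sums of saturated theta forms are saturated theta forms, at the same level.**  For rational elements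
`α_q ∈ G₁` with finite correctors `k_q` (`ιinf (α q) · k q ∈ Γ_U`, `k q` centralising `ιinf (G₁)`), `KΓ` centralising
`ιinf (G₁)`, the `KΓ`-stability (hQ) of the corrector cosets and `Δ`-correctors inside `KΓ`: every
`F ∈ thetaSpaceSatOf P ιinf Δ κ₁ τ₁ KΓ 𝓕` has `x ↦ Σ_q F (α_q x)` in `thetaSpaceSatOf P ιinf Δ κ₁ τ₁ KΓ 𝓕` (the shape of
gen 9's `exists_mem_thetaSpaceSatOf_apply_eq_leftTranslate`, with a sum and NO level change). -/
theorem exists_mem_thetaSpaceSatOf_coe_eq_sum_leftTranslate {KΓ : Subgroup GU} (α : Q → G₁) (k : Q → GU)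
    (hαk : ∀ q, ιinf (α q) * k q ∈ P.ΓU) (hk : ∀ q (x : G₁), Commute (k q) (ιinf x))
    (hKΓ : ∀ a ∈ KΓ, ∀ x : G₁, Commute a (ιinf x))
    (hQ : ∀ a ∈ KΓ, ∃ e : Q ≃ Q, ∀ q, k (e q) * a * (k q)⁻¹ ∈ KΓ)
    (hcorr : ∀ δ ∈ Δ, ∃ x ∈ KΓ, ιinf δ * x ∈ P.ΓU ∧ ∀ y : G₁, Commute x (ιinf y))
    {𝓕 : Set C(relNormOneIdeles K L ⧸ relNormOneRat K L, ℂ)} {F : weightForms Δ κ₁ τ₁}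
    (hF : F ∈ thetaSpaceSatOf P ιinf Δ κ₁ τ₁ KΓ 𝓕) :
    ∃ F' ∈ thetaSpaceSatOf P ιinf Δ κ₁ τ₁ KΓ 𝓕, (F' : G₁ → W) = fun x => ∑ q, (F : G₁ → W) (α q * x) := by
  induction hF using Submodule.iSup_induction' with
  | mem S F hFS =>
      obtain ⟨θ, hθ, rfl⟩ := Submodule.mem_map.1 hFS
      obtain ⟨θ', hθ', hθe⟩ := S.1.exists_mem_thetaForms_coe_eq_sum S.2.2 S.2.1 k hk hKΓ hQ hcorr 𝓕 hθ
      refine ⟨restrictHom ιinf (S.1.sumTranslateStrict k S.2.1 hKΓ hcorr).hΔ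
          (S.1.sumTranslateStrict k S.2.1 hKΓ hcorr).hη θ',
        restrictHom_mem_thetaSpaceSatOf _ (KTypeSituation.IsSaturated.sumTranslateStrict k S.2.1 hKΓ hcorr)
          (S.2.2.sumTranslateStrict S.2.1 k hk hKΓ hQ hcorr) hθ', ?_⟩
      funext x
      simp only [restrictHom_apply, hθe]
      refine Finset.sum_congr rfl fun q _ => ?_
      rw [comp_leftTranslate_eq_of_mem ιinf θ.2 (hαk q) (hk q) x]
  | zero => exact ⟨0, Submodule.zero_mem _, by funext x; simp⟩
  | add F G _ _ hF hG =>
      obtain ⟨F', hF', hFe⟩ := hF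
      obtain ⟨G', hG', hGe⟩ := hG
      refine ⟨F' + G', Submodule.add_mem _ hF' hG', ?_⟩
      funext x
      simp only [Submodule.coe_add, Pi.add_apply, hFe, hGe, Finset.sum_add_distrib]

end HeckeSum

end ThetaSpace
end Model
end HodgeCM

end
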